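import Mathlib
import Summits.KontsevichZagierPeriods.Zeta5Search.Families.TransportCertificate
import HarnessLib

/-!
# ζ(5) search — Families: lower bounds for growth constants by `decide` — the value of `f` at a rational point

HONEST FRAMING: systematic search; no irrationality claim unless certified.  STRUCTURAL (size of cellular integrals);
nothing about the arithmetic of any zeta value.  Seat P2, Families layer.

`Families/TransportCertificate.lean` certifies UPPER bounds on a growth constant `M = lim I(N·a)^{1/N}` by `decide`
alone.  This file does the same for LOWER bounds (the ingredient of a no-go / envelope statement: the raw integrals do
NOT decay faster than `M^N`): `M ≥ f(t)` for every point `t` of the open simplex, and at the point with prescribed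
positive integer GAPS `g_0, …, g_ℓ` (sum `D`) the value of `f` is an explicit rational number.

* `gapPoint g` — the point `t_j = (g_0 + ⋯ + g_j)/D`; `pt_gapPoint`, `gapN_gapPoint` (`= g_w/D`), `gapPoint_mem`;
* `spanSum σ g i` — the sum of the gaps spanned by the `σδ⁰`-edge at position `i` (a natural number);
* **`rayF_gapPoint`** — `f_σ(α,β)(gapPoint g) = (∏_w g_w^{α_w} · D^{Σβ}) / (∏_{i finite} spanSum_i^{β_i} · D^{Σα})`
  for exponents that are non-negative on the finite edges / gaps (`α_w`, `β_i` read through `Int.toNat`);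
* **`le_bzSup_of_natPoint`** — for `a` in the Brown–Zudilin cone: if `num · (∏_{i fin} spanSum_i^{β_i}) · D^{Σα} ≤
  den · (∏_w g_w^{α_w}) · D^{Σβ}` (a decidable `ℕ`-inequality) then **`num/den ≤ bzSup a`**;
* `le_bzSup_thm1_api` — usage: `204/10³¹ ≤ bzSup(8,16,10,15,12,16,18,13)` re-derived by `decide` from the gaps
  `(1377,1287,374,966,1470,4526)` (cf. `le_bzSup_thm1` of `RayGrowthTransport`).
Standard axioms only.
-/

noncomputable section

open MeasureTheory Set Finset Filter Topology

namespace Summit.KontsevichZagierPeriods.Zeta5Search.Families.Cellular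

open Literature.NumberTheory.Irrationality

variable {ℓ : ℕ} (σ : Fin (ℓ + 3) → Fin (ℓ + 3)) (α β : Fin (ℓ + 3) → ℤ)

/-! ### The point with prescribed integer gaps -/

/-- Partial sums of the gaps: `S g k = Σ_{w < k} g_w` (as a real number). -/
def gapPartial (g : Fin (ℓ + 1) → ℕ) (k : ℕ) : ℝ := ∑ w : Fin (ℓ + 1), if w.val < k then (g w : ℝ) else 0

/-- The point of the simplex with gaps proportional to `g`: `t_j = (g_0 + ⋯ + g_j) / (g_0 + ⋯ + g_ℓ)`. -/
def gapPoint (g : Fin (ℓ + 1) → ℕ) : Fin ℓ → ℝ :=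
  fun j => gapPartial g (j.val + 1) / gapPartial g (ℓ + 1)

/-- `S g (ℓ+1) = D`, the total. -/
theorem gapPartial_total (g : Fin (ℓ + 1) → ℕ) : gapPartial g (ℓ + 1) = ∑ w : Fin (ℓ + 1), (g w : ℝ) := by
  unfold gapPartial
  exact Finset.sum_congr rfl fun w _ => by rw [if_pos w.isLt]

/-- `S g 0 = 0`. -/
theorem gapPartial_zero (g : Fin (ℓ + 1) → ℕ) : gapPartial g 0 = 0 := by
  unfold gapPartial
  exact Finset.sum_eq_zero fun w _ => by rw [if_neg (Nat.not_lt_zero _)]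

/-- `S g (w+1) − S g w = g_w`. -/
theorem gapPartial_succ_sub (g : Fin (ℓ + 1) → ℕ) (w : Fin (ℓ + 1)) :
    gapPartial g (w.val + 1) - gapPartial g w.val = g w := by
  unfold gapPartial
  rw [← Finset.sum_sub_distrib]
  rw [Finset.sum_eq_single w]
  · simp
  · intro v _ hv
    have hv' : v.val ≠ w.val := fun h => hv (Fin.ext h)
    by_cases h1 : v.val < w.val
    · rw [if_pos (by omega), if_pos h1, sub_self]
    · rw [if_neg (by omega), if_neg h1, sub_self]
  · intro h; exact absurd (Finset.mem_univ w) h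

/-- `S g hi − S g lo = Σ_{lo ≤ w < hi} g_w` for `lo ≤ hi`. -/
theorem gapPartial_sub (g : Fin (ℓ + 1) → ℕ) {lo hi : ℕ} (h : lo ≤ hi) :
    gapPartial g hi - gapPartial g lo =
      ((∑ w : Fin (ℓ + 1), if lo ≤ w.val ∧ w.val < hi then g w else 0 : ℕ) : ℝ) := by
  unfold gapPartial
  rw [← Finset.sum_sub_distrib]
  push_cast
  refine Finset.sum_congr rfl fun w _ => ?_
  by_cases h1 : w.val < lo
  · rw [if_pos (by omega), if_pos h1, if_neg (by omega), sub_self]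
  · by_cases h2 : w.val < hi
    · rw [if_pos h2, if_neg h1, if_pos ⟨by omega, h2⟩, sub_zero]
    · rw [if_neg h2, if_neg h1, if_neg (by omega), sub_self]

variable {g : Fin (ℓ + 1) → ℕ}

/-- The total `D` is positive when all gaps are. -/
theorem gapPartial_total_pos (hg : ∀ w, 0 < g w) : 0 < gapPartial g (ℓ + 1) := by
  rw [gapPartial_total]
  exact Finset.sum_pos (fun w _ => by exact_mod_cast hg w) ⟨⟨0, by omega⟩, Finset.mem_univ _⟩

/-- The marked points of `gapPoint g`: `pt k = S g k / D` for `k ≤ ℓ + 1`. -/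
theorem pt_gapPoint (hg : ∀ w, 0 < g w) {k : ℕ} (hk : k ≤ ℓ + 1) :
    pt (gapPoint g) k = gapPartial g k / gapPartial g (ℓ + 1) := by
  unfold pt
  by_cases h0 : k = 0
  · rw [if_pos h0, h0, gapPartial_zero, zero_div]
  · rw [if_neg h0]
    by_cases h1 : k - 1 < ℓ
    · rw [dif_pos h1]
      show gapPartial g ((⟨k - 1, h1⟩ : Fin ℓ).val + 1) / gapPartial g (ℓ + 1) = _
      simp only
      rw [show k - 1 + 1 = k by omega]
    · rw [dif_neg h1, show k = ℓ + 1 by omega, div_self (gapPartial_total_pos hg).ne']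

/-- The gaps of `gapPoint g` are `g_w / D`. -/
theorem gapN_gapPoint (hg : ∀ w, 0 < g w) (w : Fin (ℓ + 1)) :
    gapN (gapPoint g) w = (g w : ℝ) / gapPartial g (ℓ + 1) := by
  unfold gapN
  rw [pt_gapPoint hg (by omega), pt_gapPoint hg (by omega), ← sub_div, gapPartial_succ_sub]

/-- `gapPoint g` lies in the open simplex when all gaps are positive. -/
theorem gapPoint_mem (hg : ∀ w, 0 < g w) : gapPoint g ∈ openSimplex ℓ := by
  rw [mem_openSimplex_iff_gapN]
  intro w
  rw [gapN_gapPoint hg]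
  exact div_pos (by exact_mod_cast hg w) (gapPartial_total_pos hg)

/-! ### The value of `f` at `gapPoint g` -/

/-- The sum of the gaps spanned by the `σδ⁰`-edge at position `i` (meaningful for finite edges). -/
def spanSum (g : Fin (ℓ + 1) → ℕ) (i : Fin (ℓ + 3)) : ℕ :=
  ∑ w : Fin (ℓ + 1), if min (σ i).val (σ (i + 1)).val ≤ w.val ∧ w.val < max (σ i).val (σ (i + 1)).val then g w else 0

/-- A finite `σδ⁰`-edge has length `spanSum / D` at `gapPoint g`. -/
theorem ef_sigma_gapPoint (hg : ∀ w, 0 < g w) (i : Fin (ℓ + 3))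
    (hi : (σ i).val ≠ ℓ + 2 ∧ (σ (i + 1)).val ≠ ℓ + 2) :
    ef (gapPoint g) (σ i) (σ (i + 1)) = (spanSum σ g i : ℝ) / gapPartial g (ℓ + 1) := by
  have h1 := (σ i).isLt
  have h2 := (σ (i + 1)).isLt
  rw [ef_sigma_of_finite σ _ i hi, pt_gapPoint hg (by omega), pt_gapPoint hg (by omega), ← sub_div,
    gapPartial_sub g (min_le_max)]
  rfl

/-- **The value of `f_σ(α,β)` at `gapPoint g`** for exponents non-negative on the finite gaps and finite edges:
`(∏_w g_w^{α_w}) · D^{Σ_{i fin} β_i} / ((∏_{i fin} spanSum_i^{β_i}) · D^{Σ_w α_w})`, all exponents through `Int.toNat`. -/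
theorem rayF_gapPoint (hg : ∀ w, 0 < g w)
    (hα : ∀ w : Fin (ℓ + 1), 0 ≤ α ⟨w.val, by omega⟩)
    (hβ : ∀ i, ((σ i).val ≠ ℓ + 2 ∧ (σ (i + 1)).val ≠ ℓ + 2) → 0 ≤ β i) :
    rayF σ α β (gapPoint g) =
      ((∏ w : Fin (ℓ + 1), g w ^ (α ⟨w.val, by omega⟩).toNat : ℕ) : ℝ) *
        gapPartial g (ℓ + 1) ^ (∑ i : Fin (ℓ + 3),
          if (σ i).val ≠ ℓ + 2 ∧ (σ (i + 1)).val ≠ ℓ + 2 then (β i).toNat else 0) /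
      (((∏ i : Fin (ℓ + 3), if (σ i).val ≠ ℓ + 2 ∧ (σ (i + 1)).val ≠ ℓ + 2 then spanSum σ g i ^ (β i).toNat else 1 :
          ℕ) : ℝ) * gapPartial g (ℓ + 1) ^ (∑ w : Fin (ℓ + 1), (α ⟨w.val, by omega⟩).toNat)) := by
  classical
  set D := gapPartial g (ℓ + 1) with hD
  have hDpos : 0 < D := gapPartial_total_pos hg
  -- numerator
  have hnum : num α (gapPoint g) =
      ((∏ w : Fin (ℓ + 1), g w ^ (α ⟨w.val, by omega⟩).toNat : ℕ) : ℝ) /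
        D ^ (∑ w : Fin (ℓ + 1), (α ⟨w.val, by omega⟩).toNat) := by
    unfold num
    rw [Fin.prod_univ_castSucc, Fin.prod_univ_castSucc]
    have e1 : ef (gapPoint g) (Fin.last (ℓ + 2)) (Fin.last (ℓ + 2) + 1) = 1 :=
      ef_succ_of_gt _ _ (by rw [Fin.val_last]; omega)
    have e2 : ef (gapPoint g) (Fin.castSucc (Fin.last (ℓ + 1))) (Fin.castSucc (Fin.last (ℓ + 1)) + 1) = 1 :=
      ef_succ_of_gt _ _ (by rw [Fin.val_castSucc, Fin.val_last]; omega)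
    rw [e1, e2, one_zpow, one_zpow, mul_one, mul_one, ← Finset.prod_pow_eq_pow_sum]
    push_cast
    rw [← Finset.prod_div_distrib]
    refine Finset.prod_congr rfl fun w _ => ?_
    have hw : (Fin.castSucc (Fin.castSucc w) : Fin (ℓ + 3)).val ≤ ℓ := by
      rw [Fin.val_castSucc, Fin.val_castSucc]; omega
    rw [ef_succ_of_le _ _ hw]
    have hg' : pt (gapPoint g) ((Fin.castSucc (Fin.castSucc w) : Fin (ℓ + 3)).val + 1) -
        pt (gapPoint g) (Fin.castSucc (Fin.castSucc w) : Fin (ℓ + 3)).val = gapN (gapPoint g) w := by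
      simp only [Fin.val_castSucc, gapN]
    rw [hg', gapN_gapPoint hg]
    have hc : (⟨w.val, by omega⟩ : Fin (ℓ + 3)) = Fin.castSucc (Fin.castSucc w) := Fin.ext (by simp)
    rw [← hc, ← div_pow]
    have hα' := hα w
    rw [← zpow_natCast, Int.toNat_of_nonneg hα']
  -- denominator
  have hden : den σ β (gapPoint g) =
      ((∏ i : Fin (ℓ + 3), if (σ i).val ≠ ℓ + 2 ∧ (σ (i + 1)).val ≠ ℓ + 2 then spanSum σ g i ^ (β i).toNat
          else 1 : ℕ) : ℝ) /
        D ^ (∑ i : Fin (ℓ + 3), if (σ i).val ≠ ℓ + 2 ∧ (σ (i + 1)).val ≠ ℓ + 2 then (β i).toNat else 0) := by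
    unfold den
    rw [← Finset.prod_pow_eq_pow_sum]
    push_cast
    rw [← Finset.prod_div_distrib]
    refine Finset.prod_congr rfl fun i _ => ?_
    by_cases hfin : (σ i).val ≠ ℓ + 2 ∧ (σ (i + 1)).val ≠ ℓ + 2
    · rw [if_pos hfin, if_pos hfin, ef_sigma_gapPoint σ hg i hfin, ← div_pow, ← zpow_natCast,
        Int.toNat_of_nonneg (hβ i hfin)]
    · rw [if_neg hfin, if_neg hfin, ef_sigma_of_infinite σ _ i hfin, one_zpow, pow_zero]
      simp
  unfold rayF
  rw [hnum, hden, div_div_eq_mul_div, div_mul_eq_mul_div, div_div]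
  congr 1
  ring

/-! ### Lower bounds by `decide` -/

/-- **Lower-bound certificate for a Brown–Zudilin ray by `decide`.**  For `a` in the cone (3) and positive integer gaps
`g` with total `D`: if `num · (∏_{i fin} spanSum_i^{β_i}) · D^{Σα} ≤ den · (∏_w g_w^{α_w}) · D^{Σβ}` in `ℕ`
(`α = bzNum a` on the gaps, `β = bzDen a` on the finite edges of `₈π₈^∨`), then `num/den ≤ bzSup a`. -/
theorem le_bzSup_of_natPoint {a : Fin 8 → ℤ} (ha : BrownZudilin2022.Converges a) (g : Fin 6 → ℕ)
    (hg : ∀ w, 0 < g w) (hα : ∀ w : Fin 6, 0 ≤ bzNum a ⟨w.val, by omega⟩)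
    (hβ : ∀ i, ((pi8dual i).val ≠ 5 + 2 ∧ (pi8dual (i + 1)).val ≠ 5 + 2) → 0 ≤ bzDen a i) {num den : ℕ}
    (hden : 0 < den)
    (hineq : num * (∏ i : Fin 8, if (pi8dual i).val ≠ 5 + 2 ∧ (pi8dual (i + 1)).val ≠ 5 + 2 then
        spanSum pi8dual g i ^ (bzDen a i).toNat else 1) * (∑ w, g w) ^ (∑ w : Fin 6, (bzNum a ⟨w.val, by omega⟩).toNat) ≤
      den * (∏ w : Fin 6, g w ^ (bzNum a ⟨w.val, by omega⟩).toNat) *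
        (∑ w, g w) ^ (∑ i : Fin 8, if (pi8dual i).val ≠ 5 + 2 ∧ (pi8dual (i + 1)).val ≠ 5 + 2 then
          (bzDen a i).toNat else 0)) :
    (num : ℝ) / den ≤ bzSup a := by
  have hmem := gapPoint_mem hg
  have h := rayF_le_raySup pi8dual (bzNum a) (bzDen a) pi8dual_bijective (homogeneous_bz a)
    (brownConvergent_bz_ray ha) hmem
  refine le_trans ?_ h
  rw [rayF_gapPoint pi8dual (bzNum a) (bzDen a) hg hα hβ]
  have hD : gapPartial g (5 + 1) = ((∑ w, g w : ℕ) : ℝ) := by rw [gapPartial_total]; push_cast; rfl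
  rw [hD]
  have hDn : 0 < ∑ w, g w := Finset.sum_pos (fun w _ => hg w) ⟨⟨0, by omega⟩, Finset.mem_univ _⟩
  have hPpos : 0 < ∏ i : Fin 8, if (pi8dual i).val ≠ 5 + 2 ∧ (pi8dual (i + 1)).val ≠ 5 + 2 then
      spanSum pi8dual g i ^ (bzDen a i).toNat else 1 := Finset.prod_pos fun i _ => by
    split_ifs with hfin
    · apply pow_pos
      -- a finite edge spans at least one gap, and all gaps are positive
      have hlt : min (pi8dual i).val (pi8dual (i + 1)).val < max (pi8dual i).val (pi8dual (i + 1)).val :=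
        min_lt_max.2 fun e => succ_ne_self i (pi8dual_bijective.1 (Fin.ext e))
      have h1 := (pi8dual i).isLt
      have h2 := (pi8dual (i + 1)).isLt
      refine Finset.sum_pos' (fun w _ => ?_) ⟨⟨min (pi8dual i).val (pi8dual (i + 1)).val, by omega⟩,
        Finset.mem_univ _, ?_⟩
      · split_ifs
        · exact (hg w).le
        · exact le_rfl
      · rw [if_pos ⟨le_rfl, hlt⟩]
        exact hg _
    · exact one_pos
  have hdenR : (0 : ℝ) < den := by exact_mod_cast hden
  have hPR : (0 : ℝ) < ((∏ i : Fin 8, if (pi8dual i).val ≠ 5 + 2 ∧ (pi8dual (i + 1)).val ≠ 5 + 2 then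
      spanSum pi8dual g i ^ (bzDen a i).toNat else 1 : ℕ) : ℝ) := by exact_mod_cast hPpos
  have hDR : (0 : ℝ) < ((∑ w, g w : ℕ) : ℝ) := by exact_mod_cast hDn
  rw [div_le_div_iff₀ hdenR (mul_pos hPR (pow_pos hDR _))]
  have key := (Nat.cast_le (α := ℝ)).2 hineq
  simp only [Nat.cast_mul, Nat.cast_pow] at key
  calc (num : ℝ) * (_ * _) = _ := by rw [← mul_assoc]
    _ ≤ _ := key
    _ = _ := by ring

set_option exponentiation.threshold 4096 in
set_option maxRecDepth 8192 in
/-- Usage example: **`204/10³¹ ≤ bzSup(8,16,10,15,12,16,18,13)`** from the gaps `(1377,1287,374,966,1470,4526)`, by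
`decide` only (cf. `le_bzSup_thm1`). -/
theorem le_bzSup_thm1_api : ((204 : ℕ) : ℝ) / (10 ^ 31 : ℕ) ≤ bzSup thm1Dir :=
  le_bzSup_of_natPoint BrownZudilin2022.converges_thm1_vector ![1377, 1287, 374, 966, 1470, 4526] (by decide)
    (by decide) (by decide) (by norm_num) (by decide)

/-! ### Basic families -/

/-- **Lower-bound certificate for a BASIC family by `decide`.**  For a bijective seating `σ` on `ℓ + 3` points and
positive integer gaps `g` with total `D`: if `num · (∏_{i finite} spanSum_i) · D^{ℓ+1} ≤ den · (∏_w g_w) · D^{#finite}`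
in `ℕ` (both `D`-powers are `D^{ℓ+1}`; they are kept so that the hypothesis is literally the instance of
`rayF_gapPoint` at `α = β = 1`), then `num/den ≤ M_σ = fSup σ`. -/
theorem le_fSup_of_natPoint (hσ : Function.Bijective σ) (g : Fin (ℓ + 1) → ℕ) (hg : ∀ w, 0 < g w) {num den : ℕ}
    (hden : 0 < den)
    (hineq : num * (∏ i : Fin (ℓ + 3), if (σ i).val ≠ ℓ + 2 ∧ (σ (i + 1)).val ≠ ℓ + 2 then
        spanSum σ g i ^ (1 : ℤ).toNat else 1) * (∑ w, g w) ^ (∑ _w : Fin (ℓ + 1), (1 : ℤ).toNat) ≤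
      den * (∏ w : Fin (ℓ + 1), g w ^ (1 : ℤ).toNat) *
        (∑ w, g w) ^ (∑ i : Fin (ℓ + 3), if (σ i).val ≠ ℓ + 2 ∧ (σ (i + 1)).val ≠ ℓ + 2 then (1 : ℤ).toNat else 0)) :
    (num : ℝ) / den ≤ fSup σ := by
  have hmem := gapPoint_mem hg
  refine le_trans ?_ (fSigma_le_fSup σ hσ hmem)
  rw [← rayF_one_one σ, rayF_gapPoint σ (fun _ => (1 : ℤ)) (fun _ => (1 : ℤ)) hg (fun _ => zero_le_one)
    (fun _ _ => zero_le_one)]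
  have hD : gapPartial g (ℓ + 1) = ((∑ w, g w : ℕ) : ℝ) := by rw [gapPartial_total]; push_cast; rfl
  rw [hD]
  have hDn : 0 < ∑ w, g w := Finset.sum_pos (fun w _ => hg w) ⟨⟨0, by omega⟩, Finset.mem_univ _⟩
  have hPpos : 0 < ∏ i : Fin (ℓ + 3), if (σ i).val ≠ ℓ + 2 ∧ (σ (i + 1)).val ≠ ℓ + 2 then
      spanSum σ g i ^ (1 : ℤ).toNat else 1 := Finset.prod_pos fun i _ => by
    split_ifs with hfin
    · apply pow_pos
      have hlt : min (σ i).val (σ (i + 1)).val < max (σ i).val (σ (i + 1)).val :=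
        min_lt_max.2 fun e => succ_ne_self i (hσ.1 (Fin.ext e))
      have h1 := (σ i).isLt
      have h2 := (σ (i + 1)).isLt
      refine Finset.sum_pos' (fun w _ => ?_) ⟨⟨min (σ i).val (σ (i + 1)).val, by omega⟩, Finset.mem_univ _, ?_⟩
      · split_ifs
        · exact (hg w).le
        · exact le_rfl
      · rw [if_pos ⟨le_rfl, hlt⟩]
        exact hg _
    · exact one_pos
  have hdenR : (0 : ℝ) < den := by exact_mod_cast hden
  have hPR : (0 : ℝ) < ((∏ i : Fin (ℓ + 3), if (σ i).val ≠ ℓ + 2 ∧ (σ (i + 1)).val ≠ ℓ + 2 then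
      spanSum σ g i ^ (1 : ℤ).toNat else 1 : ℕ) : ℝ) := by exact_mod_cast hPpos
  have hDR : (0 : ℝ) < ((∑ w, g w : ℕ) : ℝ) := by exact_mod_cast hDn
  rw [div_le_div_iff₀ hdenR (mul_pos hPR (pow_pos hDR _))]
  have key := (Nat.cast_le (α := ℝ)).2 hineq
  simp only [Nat.cast_mul, Nat.cast_pow] at key
  calc (num : ℝ) * (_ * _) = _ := by rw [← mul_assoc]
    _ ≤ _ := key
    _ = _ := by ring

/-- Usage example: `5003/10⁶ ≤ M_{₈π₈^∨}` from the gaps `(315, 100, 46, 78, 145, 316)` by `decide` only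
(cf. `le_fSup_pi8dual_cert` of `Families/BasicGrowthTransport.lean`). -/
theorem le_fSup_pi8dual_api : ((5003 : ℕ) : ℝ) / (1000000 : ℕ) ≤ fSup pi8dual :=
  le_fSup_of_natPoint pi8dual pi8dual_bijective ![315, 100, 46, 78, 145, 316] (by decide) (by norm_num) (by decide)

end Summit.KontsevichZagierPeriods.Zeta5Search.Families.Cellular
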